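import Summits.QuantumFields.BalabanUV.T4Continuum.Spine.NE4.AutonomousSchemeStable
import Literature.MathematicalPhysics.QuantumFieldTheory.Balaban1983to89.T4CurrencyMatching
import Literature.MathematicalPhysics.QuantumFieldTheory.Balaban1983to89.B13Contraction113

/-!
# Spine/NE4/AutonomousSchemeCurrency — (R47) THE COUPLING MODULUS IN ANY CURRENCY: the autonomous road with a `φ`-Lipschitz coupling dependence
# (`|φ g − φ g′|`, e.g. `φ = log` — the printed relative-chart currency), node U2 by `T4CurrencyMatching`

Cell `pub-balaban-gaps` (YM blitz G2), seat `ne4`, generation 11 (unit `pub-balaban-gaps-ne4-g11`); record `HOME/ne/NE4.md` §5 (R47).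
HONEST FRAMING as in the other `AutonomousScheme*` files: hypothesis shapes about an ABSTRACT one-step map + elementary metric bookkeeping + one-variable
complex analysis (Cauchy's estimate, the mean value inequality); NE4 (`T4CouplingMatching.ScaleShiftRate`, NOT IN PRINT — [Balaban1987RG1] = CMP **109**
p. 264) is NOT proved; nothing of Bałaban's is asserted; no status word moves (NE4 stays DEPENDENT, spine 0∕9).  One finite T⁴; NOT ℝ⁴, NOT infinite
volume, NOT a mass gap, NOT Clay.

THE POINT.  (R42)∕(R42)(e) ask the k-independent step to be Lipschitz in its COUPLING with ONE constant `ℓ` on the whole box ]0,γ]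
(`Markov.StateCouplingLipschitz`).  That is the `g`-currency, and it is NOT what a printed-type regularity delivers: Bałaban's analyticity domains in a
coupling-like parameter are RELATIVE — discs of radius proportional to `g` ([Balaban1988RG2Cluster] = CMP **116** Lemma 1 (1.34) p. 9, as read by the tree's
`T4CouplingAnalyticity.CouplingAnalyticRel`) — and Cauchy's estimate on such a disc gives a derivative bound `∝ 1∕g`, i.e. a Lipschitz constant in `log g`,
not in `g`.  On the β-side census (R40) made exactly this observation and closed node U2 in the LOG CURRENCY through `T4CurrencyMatching` (rate-loss fixed
point, sup weight `γ²∕2`, NO asymptotic-freedom lower bound).  This file does the same for the autonomous road: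
* §1 `StateCouplingLipschitzBy φ A S ℓ γ` — `dist (A g x) (A g′ x) ≤ ℓ·|φ g − φ g′|` (`φ = id` is (R42)'s shape, `stateCouplingLipschitzBy_id_iff`).
* §2 the hybrid telescoping of `AutonomousSchemeStable` VERBATIM in the currency `φ`: `dist_state_hybrid_step_by`, `dist_state_le_sum_of_stable_by`,
  `histLipschitzBy_of_stable` (`T4CurrencyMatching.HistLipschitzBy φ (cr·C·ℓ·θ^{k−i})` — same geometric profile), `ne4_of_stable_by`; node U2's OUTPUT by
  `T4CurrencyMatching.injectedRate_of_runs_by`: `injectedRate_of_stable_by` (any currency with a `CurrencyWeight φ γ w`; rate loss `θ ↦ ρ′`, window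
  `cr·C·ℓ·w·ρ′∕(ρ′−θ) ≤ (1−ρ′)∕2`, NO `EventualLowerH`), `injectedRate_of_stable_log` (`φ = log`, `w = γ²∕2`, `currencyWeight_log`).
* §3 THE LOG MODULUS DERIVED: `CouplingAnalyticRelState A S ρ M γ` (for each state `x ∈ S` and real `g ∈ ]0,γ]` an `E`-valued chart holomorphic on the disc of
  radius `ρ·g` about `g`, oscillation `≤ M`, agreeing with `t ↦ A t x` at the real couplings inside) ⟹ `StateCouplingLipschitzBy Real.log A S (M∕ρ) γ`
  (`stateCouplingLipschitzLog_of_relAnalytic`: Mathlib `Complex.norm_deriv_le_div_of_mapsTo_ball` on the disc gives `‖∂_g A g x‖ ≤ M∕(ρg)`; the real section's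
  derivative by the tree's `B13Contraction113.hasDerivAt_comp_ofReal` (imported, not restated); the substitution
  `g = e^u` makes the bound UNIFORM; `Convex.norm_image_sub_le_of_norm_hasDerivWithin_le` on `u ≤ log γ`); end to end `injectedRate_of_stable_relAnalytic`.

WHAT THIS SAYS FOR THE ROW (census (R47); classification words UNCHANGED — DEPENDENT; U2 WORK done; upstream WORK-bound LARGE; 0∕9).  With (R45)∕(R46)∕(R47) every
input of the autonomous road except the ONE Gaussian spectral datum is an ANALYTICITY-DOMAIN statement with a sup bound, in the domain SHAPES the tree reads off
print (a ball of one k-uniform norm in the complexified state; relative discs `|ζ − g| < ρ·g` in the coupling), plus the small one-step source and the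
read-out constant: no `g`-uniform Lipschitz constant, no modulus in the old activities, no asymptotic-freedom lower-bound binder, one radius.  Nothing of
Bałaban's is asserted; every one of these domain statements is UNPRINTED for RT as a map on activities.
-/

namespace Summit.QuantumFields.BalabanUV.T4Continuum.Spine.NE4

open Literature.MathematicalPhysics.QuantumFieldTheory.Balaban1983to89
open Literature.MathematicalPhysics.QuantumFieldTheory.Balaban1983to89.FlowStep
open Literature.MathematicalPhysics.QuantumFieldTheory.Balaban1983to89.T4CouplingMatching
  (ScaleShiftRate HistLipschitz FadingMemory disc)
open Literature.MathematicalPhysics.QuantumFieldTheory.Balaban1983to89.T4CurrencyMatching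
  (HistLipschitzBy CurrencyWeight currencyWeight_log currencyWeight_id injectedRate_of_runs_by)
open Literature.MathematicalPhysics.QuantumFieldTheory.Balaban1983to89.T4FlagMemory
  (extd extd_coe extd_adm Adm fadingMemory_profile)
open Finset

namespace Markov

/-! ## §1 Shape: the step is Lipschitz in the CURRENCY `φ` of the coupling -/

section Shapes

variable {X : Type*} [PseudoMetricSpace X]

/-- [shape] HYPOTHESIS SHAPE (NOT PRINTED as a quantitative statement): the step is Lipschitz in the coupling MEASURED IN THE CURRENCY `φ` on the invariant set,
`dist (A g x) (A g′ x) ≤ ℓ·|φ g − φ g′|` for `g, g′ ∈ ]0,γ]`.  `φ = id` is `StateCouplingLipschitz` (`stateCouplingLipschitzBy_id_iff`); `φ = Real.log` is the currency a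
RELATIVE analyticity domain in the coupling delivers (discs of radius `∝ g` — node U3's located reading of [Balaban1988RG2Cluster] = CMP **116** Lemma 1
(1.34) p. 9, `T4CouplingAnalyticity.CouplingAnalyticRel`; census (R40) `FadingFromRateRelAnalytic`; §3 below DERIVES it) — a `g`-UNIFORM constant in the
`g`-currency is NOT of printed type, a uniform constant in the log-currency is.  NOT a fact. [folklore] -/
def StateCouplingLipschitzBy (φ : ℝ → ℝ) (A : ℝ → X → X) (S : Set X) (ℓ γ : ℝ) : Prop :=
  ∀ g g' : ℝ, 0 < g → g ≤ γ → 0 < g' → g' ≤ γ → ∀ x ∈ S, dist (A g x) (A g' x) ≤ ℓ * |φ g - φ g'|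

/-- [bookkeeping] the `g`-currency is (R42)'s shape, definitionally. [folklore] -/
theorem stateCouplingLipschitzBy_id_iff {A : ℝ → X → X} {S : Set X} {ℓ γ : ℝ} :
    StateCouplingLipschitzBy id A S ℓ γ ↔ StateCouplingLipschitz A S ℓ γ := Iff.rfl

end Shapes

/-! ## §2 Hybrid telescoping in the currency `φ`: two-history modulus `Σ C·ℓ·θ^{j−i}·|φ g_i − φ g′_i|` under orbit stability -/

section Kernel

variable {X : Type*} [PseudoMetricSpace X] {A : ℝ → X → X} {S : Set X} {ξ : X} {r : X → ℝ} {β : HBeta} {φ : ℝ → ℝ}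
  {C θ ℓ D γ cr : ℝ}

/-- [bookkeeping] ONE COUPLING CHANGED, currency `φ`: consecutive hybrids differ at step `i` by `ℓ·|φ g_i − φ g′_i|`, propagated by `C·θ^{j−i}`
(verbatim `dist_state_hybrid_step` with the `φ`-modulus). [folklore] -/
theorem dist_state_hybrid_step_by (hInv : Invariant A S γ) (hξ : ξ ∈ S) (hst : OrbitStability A S C θ γ)
    (hlip : StateCouplingLipschitzBy φ A S ℓ γ) (hC : 0 ≤ C) (hθ : 0 ≤ θ)
    {g g' : ℕ → ℝ} (hg : Adm γ g) (hg' : Adm γ g') {i j : ℕ} (hij : i ≤ j) :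
    dist (state A ξ (hybrid g g' (i + 1)) (j + 1)) (state A ξ (hybrid g g' i) (j + 1))
      ≤ C * ℓ * θ ^ (j - i) * |φ (g i) - φ (g' i)| := by
  obtain ⟨n, rfl⟩ : ∃ n, j = i + n := ⟨j - i, by omega⟩
  rw [Nat.add_sub_cancel_left]
  have h1 := adm_hybrid hg hg' (i + 1)
  have h0 := adm_hybrid hg hg' i
  have ex1 : state A ξ (hybrid g g' (i + 1)) (i + 1) = A (g i) (state A ξ (hybrid g g' i) i) := by
    rw [state_succ, state_hybrid_succ_eq]; simp [hybrid]
  have ex0 : state A ξ (hybrid g g' i) (i + 1) = A (g' i) (state A ξ (hybrid g g' i) i) := by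
    rw [state_succ]; simp [hybrid]
  have hxi : state A ξ (hybrid g g' i) i ∈ S := state_mem hInv hξ h0 i
  have e1 : state A ξ (hybrid g g' (i + 1)) (i + n + 1) =
      iter A (hybrid g g' (i + 1)) (i + 1) n (state A ξ (hybrid g g' (i + 1)) (i + 1)) := by
    rw [show i + n + 1 = (i + 1) + n by omega]; exact state_eq_iter A ξ _ (i + 1) n
  have e0 : state A ξ (hybrid g g' i) (i + n + 1) =
      iter A (hybrid g g' (i + 1)) (i + 1) n (state A ξ (hybrid g g' i) (i + 1)) := by
    rw [show i + n + 1 = (i + 1) + n by omega, state_eq_iter A ξ _ (i + 1) n]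
    exact iter_congr n (fun m hm _ => by simp [hybrid, show ¬ m < i by omega, show ¬ m < i + 1 by omega]) _
  rw [e1, e0, ex1, ex0]
  have hm1 : A (g i) (state A ξ (hybrid g g' i) i) ∈ S := hInv _ (hg i).1 (hg i).2 _ hxi
  have hm0 : A (g' i) (state A ξ (hybrid g g' i) i) ∈ S := hInv _ (hg' i).1 (hg' i).2 _ hxi
  calc dist (iter A (hybrid g g' (i + 1)) (i + 1) n (A (g i) (state A ξ (hybrid g g' i) i)))
        (iter A (hybrid g g' (i + 1)) (i + 1) n (A (g' i) (state A ξ (hybrid g g' i) i)))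
      ≤ C * θ ^ n * dist (A (g i) (state A ξ (hybrid g g' i) i)) (A (g' i) (state A ξ (hybrid g g' i) i)) :=
        hst _ h1 (i + 1) n _ hm1 _ hm0
    _ ≤ C * θ ^ n * (ℓ * |φ (g i) - φ (g' i)|) :=
        mul_le_mul_of_nonneg_left (hlip _ _ (hg i).1 (hg i).2 (hg' i).1 (hg' i).2 _ hxi) (mul_nonneg hC (pow_nonneg hθ _))
    _ = C * ℓ * θ ^ n * |φ (g i) - φ (g' i)| := by ring

/-- **TWO-HISTORY MODULUS IN THE CURRENCY `φ`** (hybrid telescoping): for admissible `g, g′`,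
`dist (state g (j+1)) (state g′ (j+1)) ≤ Σ_{i≤j} C·ℓ·θ^{j−i}·|φ g_i − φ g′_i|`. [folklore] -/
theorem dist_state_le_sum_of_stable_by (hInv : Invariant A S γ) (hξ : ξ ∈ S) (hst : OrbitStability A S C θ γ)
    (hlip : StateCouplingLipschitzBy φ A S ℓ γ) (hC : 0 ≤ C) (hθ : 0 ≤ θ)
    {g g' : ℕ → ℝ} (hg : Adm γ g) (hg' : Adm γ g') (j : ℕ) :
    dist (state A ξ g (j + 1)) (state A ξ g' (j + 1)) ≤ ∑ i ∈ range (j + 1), C * ℓ * θ ^ (j - i) * |φ (g i) - φ (g' i)| := by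
  let f : ℕ → X := fun i => state A ξ (hybrid g g' i) (j + 1)
  have hf0 : f 0 = state A ξ g' (j + 1) := state_congr (j + 1) fun m _ => by simp [hybrid]
  have hfe : f (j + 1) = state A ξ g (j + 1) := state_congr (j + 1) fun m hm => by simp [hybrid, hm]
  rw [← hf0, ← hfe, dist_comm]
  calc dist (f 0) (f (j + 1)) ≤ ∑ i ∈ range (j + 1), dist (f i) (f (i + 1)) := dist_le_range_sum_dist f (j + 1)
    _ ≤ ∑ i ∈ range (j + 1), C * ℓ * θ ^ (j - i) * |φ (g i) - φ (g' i)| := by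
        refine Finset.sum_le_sum fun i hi => ?_
        rw [dist_comm]
        exact dist_state_hybrid_step_by hInv hξ hst hlip hC hθ hg hg' (Nat.lt_succ_iff.mp (mem_range.mp hi))

/-- **NODE U2's HISTORY MODULI IN THE CURRENCY `φ`**: `HistLipschitzBy φ (fun k i ↦ cr·C·ℓ·θ^{k−i}) γ β` — `T4CurrencyMatching`'s input shape, with the SAME geometric
profile as in the `g`-currency (`fadingMemory_of_stable`). [folklore] -/
theorem histLipschitzBy_of_stable (hInv : Invariant A S γ) (hξ : ξ ∈ S) (hst : OrbitStability A S C θ γ)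
    (hlip : StateCouplingLipschitzBy φ A S ℓ γ) (hC : 0 ≤ C) (hθ : 0 ≤ θ) (hcr : 0 ≤ cr)
    (hrep : RepresentsAut A r ξ γ β) (hr : ReadLipschitzOn r S cr) :
    HistLipschitzBy φ (fun k i => cr * C * ℓ * θ ^ (k - i)) γ β := by
  intro k p q hp hq
  rw [hrep k p hp, hrep k q hq]
  have h := dist_state_le_sum_of_stable_by hInv hξ hst hlip hC hθ (extd_adm hp) (extd_adm hq) k
  have e : ∑ i : Fin (k + 1), cr * C * ℓ * θ ^ (k - (i : ℕ)) * |φ (p i) - φ (q i)|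
      = cr * ∑ i ∈ range (k + 1), C * ℓ * θ ^ (k - i) * |φ (extd p i) - φ (extd q i)| := by
    rw [Finset.mul_sum, ← Fin.sum_univ_eq_sum_range]
    refine Finset.sum_congr rfl fun i _ => ?_
    rw [extd_coe, extd_coe]
    ring
  calc |r (state A ξ (extd p) (k + 1)) - r (state A ξ (extd q) (k + 1))|
      ≤ cr * dist (state A ξ (extd p) (k + 1)) (state A ξ (extd q) (k + 1)) :=
        hr _ (state_mem hInv hξ (extd_adm hp) _) _ (state_mem hInv hξ (extd_adm hq) _)
    _ ≤ cr * ∑ i ∈ range (k + 1), C * ℓ * θ ^ (k - i) * |φ (extd p i) - φ (extd q i)| := mul_le_mul_of_nonneg_left h hcr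
    _ = ∑ i : Fin (k + 1), cr * C * ℓ * θ ^ (k - (i : ℕ)) * |φ (p i) - φ (q i)| := e.symm

/-- **NE4 + THE `φ`-CURRENCY COMPANIONS**: `ScaleShiftRate (cr·C·D·θ) θ γ β ∧ HistLipschitzBy φ Λ γ β ∧ FadingMemory (cr·C·ℓ) θ Λ` — the scale shift does not see the
currency (it compares the SAME coupling history), only the two-history modulus does. [folklore] -/
theorem ne4_of_stable_by (hInv : Invariant A S γ) (hξ : ξ ∈ S) (hst : OrbitStability A S C θ γ)
    (hlip : StateCouplingLipschitzBy φ A S ℓ γ) (hfirst : FirstStep A ξ D γ) (hC : 0 ≤ C) (hθ : 0 ≤ θ) (hcr : 0 ≤ cr) (hℓ : 0 ≤ ℓ)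
    (hrep : RepresentsAut A r ξ γ β) (hr : ReadLipschitzOn r S cr) :
    ScaleShiftRate (cr * C * D * θ) θ γ β ∧
    HistLipschitzBy φ (fun k i => cr * C * ℓ * θ ^ (k - i)) γ β ∧
    FadingMemory (cr * C * ℓ) θ (fun k i => cr * C * ℓ * θ ^ (k - i)) :=
  ⟨scaleShiftRate_of_stable hInv hξ hst hfirst hC hθ hcr hrep hr,
   histLipschitzBy_of_stable hInv hξ hst hlip hC hθ hcr hrep hr,
   fadingMemory_of_stable hθ hcr hC hℓ⟩

/-- **NODE U2's OUTPUT IN THE CURRENCY `φ`** (composition with `T4CurrencyMatching.injectedRate_of_runs_by`, the rate-loss fixed point): for IR-pinned runs of the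
printed recursion (0.20) in ]0,γ], a currency weight `CurrencyWeight φ γ w`, a target rate `ρ ∈ ]θ, 1[` and the window `cr·C·ℓ·w·(ρ∕(ρ−θ)) ≤ (1−ρ)∕2`:
`InjectedRate (2·cr·C·D·θ∕(1−ρ)) 0 ρ` — NO eventual lower bound `EventualLowerH`, ONE radius; the price is the rate loss `θ ↦ ρ`.  Bookkeeping over UNPRINTED
inputs; nothing of [Balaban1987RG1] is asserted. [folklore] -/
theorem injectedRate_of_stable_by {ρ w : ℝ} (g : ℕ → ℕ → ℝ) (gIR : ℝ)
    (hρ1 : ρ < 1) (hθ0 : 0 < θ) (hθρ : θ < ρ) (hC : 0 ≤ C) (hcr : 0 ≤ cr) (hℓ : 0 ≤ ℓ) (hD : 0 ≤ D) (hw : 0 ≤ w)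
    (hInv : Invariant A S γ) (hξ : ξ ∈ S) (hst : OrbitStability A S C θ γ)
    (hlip : StateCouplingLipschitzBy φ A S ℓ γ) (hfirst : FirstStep A ξ D γ)
    (hrep : RepresentsAut A r ξ γ β) (hr : ReadLipschitzOn r S cr) (hφ : CurrencyWeight φ γ w)
    (hrun : ∀ K, RGEqH K β (g K)) (hbox : ∀ K i, i ≤ K → 0 < g K i ∧ g K i ≤ γ) (hpin : ∀ K, g K K = gIR)
    (hsmall : cr * C * ℓ * w * (ρ / (ρ - θ)) ≤ (1 - ρ) / 2) :
    T4CauchySum.InjectedRate (2 * (cr * C * D * θ) / (1 - ρ)) 0 ρ (fun K j => disc (g K) (g (K + 1)) j) := by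
  obtain ⟨hS, hL, hΛ⟩ := ne4_of_stable_by hInv hξ hst hlip hfirst hC hθ0.le hcr hℓ hrep hr
  exact injectedRate_of_runs_by g gIR (hθ0.trans hθρ) hρ1 hθ0.le hθρ.le hθ0.le hθρ
    (mul_nonneg (mul_nonneg (mul_nonneg hcr hC) hD) hθ0.le) (mul_nonneg (mul_nonneg hcr hC) hℓ) hw hrun hbox hpin hS hL hΛ hφ hsmall

/-- **THE LOG-CURRENCY FACE** (`φ = Real.log`, weight `γ²∕2` by `T4CurrencyMatching.currencyWeight_log`): a step that is `ℓ`-Lipschitz in `log g` on the invariant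
set — the currency of a RELATIVE analyticity domain in the coupling — closes node U2 with the window `cr·C·ℓ·(γ²∕2)·(ρ∕(ρ−θ)) ≤ (1−ρ)∕2`, no AF lower-bound binder.
[folklore] -/
theorem injectedRate_of_stable_log {ρ : ℝ} (g : ℕ → ℕ → ℝ) (gIR : ℝ)
    (hγ : 0 < γ) (hρ1 : ρ < 1) (hθ0 : 0 < θ) (hθρ : θ < ρ) (hC : 0 ≤ C) (hcr : 0 ≤ cr) (hℓ : 0 ≤ ℓ) (hD : 0 ≤ D)
    (hInv : Invariant A S γ) (hξ : ξ ∈ S) (hst : OrbitStability A S C θ γ)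
    (hlip : StateCouplingLipschitzBy Real.log A S ℓ γ) (hfirst : FirstStep A ξ D γ)
    (hrep : RepresentsAut A r ξ γ β) (hr : ReadLipschitzOn r S cr)
    (hrun : ∀ K, RGEqH K β (g K)) (hbox : ∀ K i, i ≤ K → 0 < g K i ∧ g K i ≤ γ) (hpin : ∀ K, g K K = gIR)
    (hsmall : cr * C * ℓ * (γ ^ 2 / 2) * (ρ / (ρ - θ)) ≤ (1 - ρ) / 2) :
    T4CauchySum.InjectedRate (2 * (cr * C * D * θ) / (1 - ρ)) 0 ρ (fun K j => disc (g K) (g (K + 1)) j) :=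
  injectedRate_of_stable_by g gIR hρ1 hθ0 hθρ hC hcr hℓ hD (by positivity) hInv hξ hst hlip hfirst hrep hr
    (currencyWeight_log hγ) hrun hbox hpin hsmall

end Kernel

/-! ## §3 The log-currency modulus DERIVED from RELATIVE analyticity in the coupling (Cauchy on the disc of radius `ρ·g`, then `g = e^u`) -/

section RelAnalytic

open Set Metric Filter Topology

variable {E : Type*} [NormedAddCommGroup E] [NormedSpace ℂ E] {A : ℝ → E → E} {S : Set E} {ρ M γ : ℝ}

/-- [shape] HYPOTHESIS SHAPE — **RELATIVE ANALYTIC CHARTS OF THE STEP IN THE COUPLING** (the state analogue of census (R40)'s `LocalAnalyticRel`; the disc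
shape of `T4CouplingAnalyticity.CouplingAnalyticRel`, node U3's located reading of [Balaban1988RG2Cluster] (1.34) p. 9): for every state `x ∈ S` and real
coupling `g ∈ ]0,γ]` some `Φ : ℂ → E` holomorphic on the open disc of radius `ρ·g` about `g`, oscillating by at most `M` there, has `Φ t = A t x` for the real
`t ∈ ]0,γ]` with `|t − g| < ρ·g`.  No analyticity at `g = 0`; `ρ`, `M` uniform.  NOT a fact; UNPRINTED for Bałaban's RT as a statement about the state map. [folklore] -/
def CouplingAnalyticRelState (A : ℝ → E → E) (S : Set E) (ρ M γ : ℝ) : Prop :=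
  ∀ x ∈ S, ∀ g ∈ Ioc (0 : ℝ) γ, ∃ Φ : ℂ → E, DifferentiableOn ℂ Φ (ball (g : ℂ) (ρ * g)) ∧
    (∀ z ∈ ball (g : ℂ) (ρ * g), ‖Φ z - Φ (g : ℂ)‖ ≤ M) ∧ ∀ t ∈ Ioc (0 : ℝ) γ, |t - g| < ρ * g → Φ (t : ℂ) = A t x

/-- **THE LOG-LIPSCHITZ COUPLING MODULUS FROM RELATIVE CHARTS**: `CouplingAnalyticRelState A S ρ M γ` (`ρ > 0`, `γ > 0`) ⟹
`StateCouplingLipschitzBy Real.log A S (M∕ρ) γ` — at each real `g` Cauchy's estimate on the disc of radius `ρ·g` (Mathlib `Complex.norm_deriv_le_div_of_mapsTo_ball`)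
gives `‖∂_g A g x‖ ≤ M∕(ρ·g)`; with `g = e^u` the bound is UNIFORM (`M∕ρ`) and the mean value inequality on `u ≤ log γ` concludes.  The `1∕g` of the relative
domain is absorbed EXACTLY by the log currency (census (R40)'s mechanism, here for the state map). [folklore] -/
theorem stateCouplingLipschitzLog_of_relAnalytic (hρ : 0 < ρ) (hγ : 0 < γ) (h : CouplingAnalyticRelState A S ρ M γ) :
    StateCouplingLipschitzBy Real.log A S (M / ρ) γ := by
  intro g g' hg0 hgγ hg0' hgγ' x hx
  -- the real section through the fixed state `x`
  let f : ℝ → E := fun t => A t x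
  -- at every real coupling: a derivative WITHIN ]0,γ] with norm ≤ (M/ρ)/t
  have hderiv : ∀ t ∈ Ioc (0 : ℝ) γ, ∃ φ' : E, HasDerivWithinAt f φ' (Ioc (0 : ℝ) γ) t ∧ ‖φ'‖ ≤ M / ρ / t := by
    intro t ht
    obtain ⟨Φ, hdiff, hbnd, hagree⟩ := h x hx t ht
    have ht0 : 0 < t := ht.1
    have hr : 0 < ρ * t := mul_pos hρ ht0
    have hmaps : MapsTo Φ (ball (t : ℂ) (ρ * t)) (closedBall (Φ (t : ℂ)) M) := fun z hz =>
      mem_closedBall.mpr (by rw [dist_eq_norm]; exact hbnd z hz)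
    have hd : ‖deriv Φ (t : ℂ)‖ ≤ M / (ρ * t) := Complex.norm_deriv_le_div_of_mapsTo_ball hdiff hmaps hr
    have hΦt : Φ (t : ℂ) = f t := hagree t ht (by simpa using hr)
    have hΦat : HasDerivAt (fun u : ℝ => Φ (u : ℂ)) (deriv Φ (t : ℂ)) t :=
      B13Contraction113.hasDerivAt_comp_ofReal (hdiff.differentiableAt (isOpen_ball.mem_nhds (mem_ball_self hr))).hasDerivAt
    have hcongr : f =ᶠ[𝓝[Ioc (0 : ℝ) γ] t] fun u : ℝ => Φ (u : ℂ) := by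
      have hnhd : Ioc (0 : ℝ) γ ∩ Ioo (t - ρ * t) (t + ρ * t) ∈ 𝓝[Ioc (0 : ℝ) γ] t :=
        inter_mem_nhdsWithin _ (Ioo_mem_nhds (show t - ρ * t < t by linarith) (show t < t + ρ * t by linarith))
      filter_upwards [hnhd] with u hu
      exact (hagree u hu.1 (abs_sub_lt_iff.mpr ⟨by linarith [hu.2.2], by linarith [hu.2.1]⟩)).symm
    refine ⟨deriv Φ (t : ℂ), hΦat.hasDerivWithinAt.congr_of_eventuallyEq hcongr hΦt.symm, hd.trans (le_of_eq ?_)⟩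
    rw [div_div]
  choose! φ' hφ' using hderiv
  -- the substitution `g = e^u`: a UNIFORM derivative bound `M/ρ` on `u ≤ log γ`
  let G : ℝ → E := fun v => f (Real.exp v)
  have hmapsE : MapsTo Real.exp (Iic (Real.log γ)) (Ioc (0 : ℝ) γ) := fun v hv =>
    ⟨Real.exp_pos v, by simpa [Real.exp_log hγ] using Real.exp_le_exp.mpr (mem_Iic.mp hv)⟩
  have hG : ∀ v ∈ Iic (Real.log γ), HasDerivWithinAt G (Real.exp v • φ' (Real.exp v)) (Iic (Real.log γ)) v := fun v hv =>
    (hφ' (Real.exp v) (hmapsE hv)).1.scomp v (Real.hasDerivAt_exp v).hasDerivWithinAt hmapsE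
  have hGb : ∀ v ∈ Iic (Real.log γ), ‖Real.exp v • φ' (Real.exp v)‖ ≤ M / ρ := fun v hv => by
    have hb := (hφ' (Real.exp v) (hmapsE hv)).2
    rw [norm_smul, Real.norm_eq_abs, abs_of_pos (Real.exp_pos v)]
    calc Real.exp v * ‖φ' (Real.exp v)‖ ≤ Real.exp v * (M / ρ / Real.exp v) :=
          mul_le_mul_of_nonneg_left hb (Real.exp_pos v).le
      _ = M / ρ := mul_div_cancel₀ _ (Real.exp_pos v).ne'
  have hlg : Real.log g ∈ Iic (Real.log γ) := mem_Iic.mpr (Real.log_le_log hg0 hgγ)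
  have hlg' : Real.log g' ∈ Iic (Real.log γ) := mem_Iic.mpr (Real.log_le_log hg0' hgγ')
  have hmvt := (convex_Iic (Real.log γ)).norm_image_sub_le_of_norm_hasDerivWithin_le hG hGb hlg' hlg
  have e1 : G (Real.log g) = A g x := by change A (Real.exp (Real.log g)) x = A g x; rw [Real.exp_log hg0]
  have e2 : G (Real.log g') = A g' x := by change A (Real.exp (Real.log g')) x = A g' x; rw [Real.exp_log hg0']
  rw [e1, e2, Real.norm_eq_abs] at hmvt
  rw [dist_eq_norm]
  exact hmvt

/-- **NODE U2's OUTPUT FROM ORBIT STABILITY + RELATIVE ANALYTIC CHARTS IN THE COUPLING** (§3 ∘ §2, log currency, weight `γ²∕2`): the coupling-Lipschitz input of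
(R42) is replaced by the printed-DOMAIN shape `CouplingAnalyticRelState A S ρ M γ`; window `cr·C·(M∕ρ)·(γ²∕2)·(ρ′∕(ρ′−θ)) ≤ (1−ρ′)∕2`, output
`InjectedRate (2·cr·C·D·θ∕(1−ρ′)) 0 ρ′` at any `ρ′ ∈ ]θ,1[`; NO `EventualLowerH`, NO g-uniform Lipschitz constant.  Bookkeeping over UNPRINTED inputs. [folklore] -/
theorem injectedRate_of_stable_relAnalytic {ξ : E} {r : E → ℝ} {β : HBeta} {C θ D cr ρ' : ℝ} (g : ℕ → ℕ → ℝ) (gIR : ℝ)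
    (hγ : 0 < γ) (hρ : 0 < ρ) (hM : 0 ≤ M) (hρ'1 : ρ' < 1) (hθ0 : 0 < θ) (hθρ' : θ < ρ') (hC : 0 ≤ C) (hcr : 0 ≤ cr) (hD : 0 ≤ D)
    (hInv : Invariant A S γ) (hξ : ξ ∈ S) (hst : OrbitStability A S C θ γ)
    (han : CouplingAnalyticRelState A S ρ M γ) (hfirst : FirstStep A ξ D γ)
    (hrep : RepresentsAut A r ξ γ β) (hr : ReadLipschitzOn r S cr)
    (hrun : ∀ K, RGEqH K β (g K)) (hbox : ∀ K i, i ≤ K → 0 < g K i ∧ g K i ≤ γ) (hpin : ∀ K, g K K = gIR)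
    (hsmall : cr * C * (M / ρ) * (γ ^ 2 / 2) * (ρ' / (ρ' - θ)) ≤ (1 - ρ') / 2) :
    T4CauchySum.InjectedRate (2 * (cr * C * D * θ) / (1 - ρ')) 0 ρ' (fun K j => disc (g K) (g (K + 1)) j) :=
  injectedRate_of_stable_log g gIR hγ hρ'1 hθ0 hθρ' hC hcr (div_nonneg hM hρ.le) hD hInv hξ hst
    (stateCouplingLipschitzLog_of_relAnalytic hρ hγ han) hfirst hrep hr hrun hbox hpin hsmall

end RelAnalytic

end Markov

end Summit.QuantumFields.BalabanUV.T4Continuum.Spine.NE4
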